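import Summits.BirchSwinnertonDyer.BirchSwinnertonDyer.Theses.ResidualThetaTransportAtTwo
import Summits.BirchSwinnertonDyer.BirchSwinnertonDyer.Theorems.ResidualThetaTransportAtTwoSignedMuVanishingAtTwoPlusLineV4
import Summits.BirchSwinnertonDyer.BirchSwinnertonDyer.Theorems.ResidualThetaTransportAtTwoSignedMuVanishingAtTwoPlusSel2
import Summits.BirchSwinnertonDyer.BirchSwinnertonDyer.Theorems.ResidualThetaTransportAtTwoSignedMuPropagationAtTwoRSel2Transfer
import HarnessLib

/-!
# Route `ResidualThetaTransportAtTwo`, crux Kμ⁺ `SignedMuVanishingAtTwoPlus` (stmt-BirchSwinnertonDyer-20689):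
# the line `birth` v4.2 END TO END — with the propagation stub PROVED, the crux is EXACTLY «analytic child ∧ seed child»

Lead line `birth` v4.2 (seat bsd-wall-rtt-p4 g3; skeleton `Cruxes/SignedMuVanishingAtTwoPlus/Lines/birth.lean`; registered
stubs `stub_residualSeedAtTwo` = child 21438 `SignedMuSeedAtTwoPlus` BY NAME, `stub_periodUnitAtTwo` (PER),
`stub_flatMuZeroAtTwo` (FLAT); the v4 stub `stub_propagationR` = item 22891 `SignedMuPropagationAtTwoR` is now a THEOREM:
width seat rtt-p4-w3's `Sel2TransferAtTwo.sel2Transfer` (p584569, assembled over lead tp2-p1's residual dévissage) composed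
with width seat rtt-p4-w2's `signedMuPropagationAtTwoR_of_sel2Transfer` (p580570)). THEOREMS ONLY (no `def`, no named fact,
no `sorry`); the open stub statements enter as hypotheses — the seed BY NAME (it is a route item), PER / FLAT verbatim;
nothing about any curve is asserted; BSD is not proved by this.

* §1 `muAlgebraic_iff_signedMuSeedAtTwoPlus` — with propagation proved, the ALGEBRAIC HALF of the crux (conjunct 1
  verbatim) is EQUIVALENT to the seed child 21438 (⇒: `A := W`; ⇐: seed + the proved 22891).
* §2 `signedMuVanishingAtTwoPlus_iff_analytic_and_seed` — KERNEL-EXACT, no print fact: the crux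
  `SignedMuVanishingAtTwoPlus` ⟺ `SignedMuAnalyticAtTwoPlus ∧ SignedMuSeedAtTwoPlus` (children 21437 ∧ 21438 BY NAME).
  Of the planner's split {21437, 21438, 21439} + glue 21440 the third child is no longer needed on the habitat⁺
  (its narrowed form 22891 is proved); the parent is literally the conjunction of the other two.
* §3 SUFFICIENCY in the line's analytic currency: `signedMuVanishingAtTwoPlus_of_seed_of_periodUnit_of_flatMuZero`
  (21438 ∧ PER ∧ FLAT ⇒ crux) and `…_of_seed_of_abbesUllmo_of_flatMuZero` (21438 ∧ Abbes–Ullmo Thm A ∧ FLAT ⇒ crux):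
  the v4.2 line is CLOSED MODULO {item 21438, the AU fact, FLAT} — one hypothesis fewer than lead g2's p581883.
* §4 NECESSITY: granted PER (resp. AU) the crux ⟺ «21438 ∧ FLAT»
  (`signedMuVanishingAtTwoPlus_iff_seed_and_flatMuZero_of_periodUnit`, `…_of_abbesUllmo`), by g2's
  `flatMuZero_of_crux_of_periodUnit` and §1.

References: R. Greenberg, V. Vatsal, Invent. Math. 142 (2000) p. 3, Prop. (2.8) [GreenbergVatsal2000]; B. D. Kim,
Compositio Math. 145 (2009) Prop. 2.12, Cor. 2.13 [BDKim2009]; R. Pollack, Duke Math. J. 118 (2003) Prop. 6.18, Conj. 6.3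
[Pollack2003]; A. Abbes, E. Ullmo, Compositio Math. 103 (1996) Thm. A [AbbesUllmo1996].
-/

set_option autoImplicit false
set_option linter.dupNamespace false

noncomputable section

open scoped Classical MatrixGroups ModularForm

open CongruenceSubgroup WeierstrassCurve Literature.NumberTheory.EllipticCurves
  Literature.NumberTheory.EllipticCurves.IwasawaAlgebra Literature.NumberTheory.EllipticCurves.ModularForms
  Literature.NumberTheory.EllipticCurves.Rank1Residual Literature.NumberTheory.EllipticCurves.Kobayashi2003
  Summit.BirchSwinnertonDyer.Rank1Residual.Supersingular Summit.BirchSwinnertonDyer.Rank1Residual.X1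
  Summit.BirchSwinnertonDyer.BirchSwinnertonDyer.Theses.ResidualThetaTransportAtTwo

namespace Summit.BirchSwinnertonDyer.BirchSwinnertonDyer.Theorems.SignedMuAtTwo

/-! ## §1. The algebraic half ⟺ the seed child (propagation is a theorem) -/

/-- **With the propagation at `2` PROVED, the algebraic half of Kμ⁺ IS the seed child.** On the habitat⁺
(`¬ CM`, `r_an = 0`, good supersingular at `2`, `a₂ = 0`, `Δ_W < 0`): «every finitely generated `+` signed Selmer dual of `W`
over the cyclotomic `ℤ₂`-extension is `Λ`-torsion with `μ = 0`» holds for every habitat⁺ curve IFF `SignedMuSeedAtTwoPlus`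
(child 21438: every habitat⁺ curve is congruent mod `2` to SOME good-supersingular `a₂ = 0` curve with that property).
⇒: take `A := W` with the identity of `W[2]`; ⇐: the seed's partner `A` and the PROVED narrowed propagation item 22891
(`signedMuPropagationAtTwoR_of_sel2Transfer` ∘ `Sel2TransferAtTwo.sel2Transfer`: Greenberg–Vatsal Prop. (2.8) / B. D. Kim
Cor. 2.13 read at `2` for `Δ_W < 0`). [cite: GreenbergVatsal2000, p. 3 and Prop. (2.8)] [cite: BDKim2009, Prop. 2.12 and Cor. 2.13] -/
theorem muAlgebraic_iff_signedMuSeedAtTwoPlus :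
    (∀ (W : WeierstrassCurve ℚ) [W.IsElliptic] [W.IsGloballyMinimal], ¬ W.HasCM → W.analyticRank = 0 →
        GoodSS W 2 → W.frobeniusTrace 2 = 0 → W.Δ < 0 →
        ∀ (κ : ZpExtension ℚ 2) (γ : Field.absoluteGaloisGroup ℚ), κ.IsCyclotomic → κ.IsTopGenerator γ →
        ∀ (D : SignedSelmerDualData W κ γ 1) [Module.Finite (IwasawaAlgebra 2) D.X],
          Module.IsTorsion (IwasawaAlgebra 2) D.X ∧ D.mu = 0) ↔
      SignedMuSeedAtTwoPlus := by
  constructor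
  · intro h W hW hW' hCM hr hss ha hΔ
    exact ⟨W, hW, hW', hss, ha, ⟨AddEquiv.refl _, fun _ _ ↦ rfl⟩, h W hCM hr hss ha hΔ⟩
  · intro hSeed
    exact muAlgebraic_of_seed_of_propagationR hSeed
      (signedMuPropagationAtTwoR_of_sel2Transfer Sel2TransferAtTwo.sel2Transfer)

/-! ## §2. KERNEL-EXACT: the crux ⟺ analytic child ∧ seed child -/

/-- **Kμ⁺ is EXACTLY the conjunction of two of its three children.** With item 22891 proved,
`SignedMuVanishingAtTwoPlus ↔ SignedMuAnalyticAtTwoPlus ∧ SignedMuSeedAtTwoPlus` (children 21437, 21438 BY NAME; no print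
fact, no period hypothesis): ⇒ conjunct 2 is 21437 verbatim and conjunct 1 gives 21438 with `A := W`; ⇐ by §1. So the
planner's split {21437 analytic, 21438 seed, 21439 propagation} of the parent needs its third child only in the narrowed,
now-proved form 22891, and the glue 21440 specialises to this equivalence. [cite: GreenbergVatsal2000, p. 3 and Prop. (2.8)]
[cite: BDKim2009, Cor. 2.13] -/
theorem signedMuVanishingAtTwoPlus_iff_analytic_and_seed :
    SignedMuVanishingAtTwoPlus ↔ SignedMuAnalyticAtTwoPlus ∧ SignedMuSeedAtTwoPlus := by
  constructor
  · intro h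
    exact ⟨fun W _ _ hCM hr hss ha hΔ ↦ (h W hCM hr hss ha hΔ).2,
      muAlgebraic_iff_signedMuSeedAtTwoPlus.mp fun W _ _ hCM hr hss ha hΔ ↦ (h W hCM hr hss ha hΔ).1⟩
  · rintro ⟨hAn, hSeed⟩ W _ _ hCM hr hss ha hΔ
    exact ⟨muAlgebraic_iff_signedMuSeedAtTwoPlus.mpr hSeed W hCM hr hss ha hΔ, hAn W hCM hr hss ha hΔ⟩

/-- The crux from its two remaining children BY NAME (the ⇐ half of §2, for citation). [cite: GreenbergVatsal2000, Prop. (2.8)] -/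
theorem signedMuVanishingAtTwoPlus_of_analytic_of_seed (hAn : SignedMuAnalyticAtTwoPlus) (hSeed : SignedMuSeedAtTwoPlus) :
    SignedMuVanishingAtTwoPlus :=
  signedMuVanishingAtTwoPlus_iff_analytic_and_seed.mpr ⟨hAn, hSeed⟩

/-! ## §3. Sufficiency in the line's analytic currency: 21438 ∧ PER ∧ FLAT ⇒ the crux -/

/-- **THE v4.2 LINE, END TO END**: SEED (child 21438) ∧ PER (the period unit at `2`, stub `stub_periodUnitAtTwo` verbatim)
∧ FLAT (`2 ∤ L♭` for every Pollack pair at `2` of every habitat⁺ newform, stub `stub_flatMuZeroAtTwo` verbatim) ⇒ the crux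
decl `SignedMuVanishingAtTwoPlus` BY NAME — lead g2's four-hypothesis certificate (p581883) with the propagation hypothesis
DISCHARGED. [cite: Pollack2003, Prop. 6.18] [cite: GreenbergVatsal2000, p. 3 and Prop. (2.8)] -/
theorem signedMuVanishingAtTwoPlus_of_seed_of_periodUnit_of_flatMuZero (hSeed : SignedMuSeedAtTwoPlus)
    (hper : ∀ (W : WeierstrassCurve ℚ) [W.IsElliptic] [W.IsGloballyMinimal], GoodSS W 2 →
      ∀ [NeZero (W.conductorNorm ℤ)] (f : CuspForm (Gamma0 (W.conductorNorm ℤ)) 2), IsNewformOf W f →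
      ∃ u : ℚ, ‖(u : ℚ_[2])‖ = 1 ∧ W.realPeriodRat = u * plusPeriod f)
    (hflat : ∀ (W : WeierstrassCurve ℚ) [W.IsElliptic] [W.IsGloballyMinimal], ¬ W.HasCM →
      W.analyticRank = 0 → GoodSS W 2 → W.frobeniusTrace 2 = 0 → W.Δ < 0 →
      ∀ [NeZero (W.conductorNorm ℤ)] (f : CuspForm (Gamma0 (W.conductorNorm ℤ)) 2), IsNewformOf W f →
      ∀ (Lplus Lminus : IwasawaAlgebra 2), IsPollackPair f 2 Lplus Lminus →
      ¬ PowerSeries.C (2 : ℤ_[2]) ∣ Lminus) :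
    SignedMuVanishingAtTwoPlus :=
  signedMuVanishingAtTwoPlus_of_seed_of_propagationR_of_periodUnit_of_flatMuZero hSeed
    (signedMuPropagationAtTwoR_of_sel2Transfer Sel2TransferAtTwo.sel2Transfer) hper hflat

/-- **The v4.2 line GRANTED Abbes–Ullmo**: SEED ∧ the print fact `abbesUllmo_not_dvd_maninConstant_of_not_dvd_level`
(Abbes–Ullmo 1996 Thm A, statement-only in the tree) ∧ FLAT ⇒ the crux BY NAME. So the line is CLOSED MODULO
{item 21438, AU, FLAT}. [cite: AbbesUllmo1996, Thm. A] [cite: Pollack2003, Prop. 6.18] -/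
theorem signedMuVanishingAtTwoPlus_of_seed_of_abbesUllmo_of_flatMuZero (hSeed : SignedMuSeedAtTwoPlus)
    (hAU : abbesUllmo_not_dvd_maninConstant_of_not_dvd_level)
    (hflat : ∀ (W : WeierstrassCurve ℚ) [W.IsElliptic] [W.IsGloballyMinimal], ¬ W.HasCM →
      W.analyticRank = 0 → GoodSS W 2 → W.frobeniusTrace 2 = 0 → W.Δ < 0 →
      ∀ [NeZero (W.conductorNorm ℤ)] (f : CuspForm (Gamma0 (W.conductorNorm ℤ)) 2), IsNewformOf W f →
      ∀ (Lplus Lminus : IwasawaAlgebra 2), IsPollackPair f 2 Lplus Lminus →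
      ¬ PowerSeries.C (2 : ℤ_[2]) ∣ Lminus) :
    SignedMuVanishingAtTwoPlus :=
  signedMuVanishingAtTwoPlus_of_seed_of_propagationR_of_abbesUllmo_of_flatMuZero hSeed
    (signedMuPropagationAtTwoR_of_sel2Transfer Sel2TransferAtTwo.sel2Transfer) hAU hflat

/-! ## §4. Necessity: granted the period unit, the crux ⟺ «21438 ∧ FLAT» -/

/-- **Granted PER, Kμ⁺ ⟺ seed child ∧ FLAT.** ⇒: the seed with `A := W` and g2's `flatMuZero_of_crux_of_periodUnit`;
⇐: §3. So of the three open stubs of line `birth` v4.2 the period unit is print (Abbes–Ullmo) and the other two are each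
NECESSARY for the crux — the line loses nothing. [cite: Pollack2003, Prop. 6.18] [cite: GreenbergVatsal2000, §3, Remark 3.4] -/
theorem signedMuVanishingAtTwoPlus_iff_seed_and_flatMuZero_of_periodUnit
    (hper : ∀ (W : WeierstrassCurve ℚ) [W.IsElliptic] [W.IsGloballyMinimal], GoodSS W 2 →
      ∀ [NeZero (W.conductorNorm ℤ)] (f : CuspForm (Gamma0 (W.conductorNorm ℤ)) 2), IsNewformOf W f →
      ∃ u : ℚ, ‖(u : ℚ_[2])‖ = 1 ∧ W.realPeriodRat = u * plusPeriod f) :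
    SignedMuVanishingAtTwoPlus ↔
      (SignedMuSeedAtTwoPlus ∧
      (∀ (W : WeierstrassCurve ℚ) [W.IsElliptic] [W.IsGloballyMinimal], ¬ W.HasCM →
        W.analyticRank = 0 → GoodSS W 2 → W.frobeniusTrace 2 = 0 → W.Δ < 0 →
        ∀ [NeZero (W.conductorNorm ℤ)] (f : CuspForm (Gamma0 (W.conductorNorm ℤ)) 2), IsNewformOf W f →
        ∀ (Lplus Lminus : IwasawaAlgebra 2), IsPollackPair f 2 Lplus Lminus →
        ¬ PowerSeries.C (2 : ℤ_[2]) ∣ Lminus)) := by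
  constructor
  · intro h
    exact ⟨signedMuSeedAtTwoPlus_of_signedMuVanishingAtTwoPlus h, flatMuZero_of_crux_of_periodUnit h hper⟩
  · rintro ⟨hSeed, hflat⟩
    exact signedMuVanishingAtTwoPlus_of_seed_of_periodUnit_of_flatMuZero hSeed hper hflat

/-- The same equivalence GRANTED the print fact Abbes–Ullmo Thm A in place of PER: Kμ⁺ ⟺ «21438 ∧ FLAT».
[cite: AbbesUllmo1996, Thm. A] [cite: Pollack2003, Prop. 6.18] -/
theorem signedMuVanishingAtTwoPlus_iff_seed_and_flatMuZero_of_abbesUllmo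
    (hAU : abbesUllmo_not_dvd_maninConstant_of_not_dvd_level) :
    SignedMuVanishingAtTwoPlus ↔
      (SignedMuSeedAtTwoPlus ∧
      (∀ (W : WeierstrassCurve ℚ) [W.IsElliptic] [W.IsGloballyMinimal], ¬ W.HasCM →
        W.analyticRank = 0 → GoodSS W 2 → W.frobeniusTrace 2 = 0 → W.Δ < 0 →
        ∀ [NeZero (W.conductorNorm ℤ)] (f : CuspForm (Gamma0 (W.conductorNorm ℤ)) 2), IsNewformOf W f →
        ∀ (Lplus Lminus : IwasawaAlgebra 2), IsPollackPair f 2 Lplus Lminus →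
        ¬ PowerSeries.C (2 : ℤ_[2]) ∣ Lminus)) :=
  signedMuVanishingAtTwoPlus_iff_seed_and_flatMuZero_of_periodUnit
    (fun _ _ _ hss _ _ hf ↦ exists_periodUnit_two_of_abbesUllmo hAU hss hf)

end Summit.BirchSwinnertonDyer.BirchSwinnertonDyer.Theorems.SignedMuAtTwo

end
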